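import Mathlib
import Literature.Barriers.AnomalousDissipation.ClassicalEulerLimitProofs
import HarnessLib

/-!
# Dipole kernel (`ℓ = 1`) of the adjoint Enskog test family: the weight and its tail

Helper analysis for the stub `kernelDipole` of the refutation line of `AdjointEnskogTestFamilyR`:
the dipole velocity weight `ϑ¹_R(E) = √E (1+E)⁻⁴ e^{-E/R}` in the energy variable `E = |v|²`,
its tail `Θ̄¹_R(x) = ∫_{E > x} ϑ¹_R(E) dE`, elementary bounds (`ϑ¹_R ≤ ½(1+E)⁻³`,
`Θ̄¹_R(x) ≤ ¼(1+x)⁻²`, a Lipschitz-type increment bound), a generic "tail below a primitive"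
comparison lemma, and the two model integrals `∫₀^∞ dE/(√E(1+E)) = π`, `∫₀^∞ R⁻¹e^{-E/R} dE = 1`
used as dominating functions.  Everything is elementary real analysis (no `rpow`); the weight and
its tail are written out explicitly (no auxiliary definitions).
-/

noncomputable section

namespace Summit.AtomisticToContinuum.HydrodynamicLimit.Theorems.EnskogAdjointDuality

open MeasureTheory Set Filter
open scoped Real Topology

/-- `ϑ¹_R ≥ 0`. -/
theorem k2r_ref_K1_th_nonneg (R E : ℝ) : 0 ≤ (Real.sqrt E * ((1 + E) ^ 4)⁻¹ * Real.exp (-E / R)) := by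
  positivity

/-- `ϑ¹_R(E) = 0` for `E ≤ 0` (junk value of `√`). -/
theorem k2r_ref_K1_th_of_nonpos (R : ℝ) {E : ℝ} (hE : E ≤ 0) : (Real.sqrt E * ((1 + E) ^ 4)⁻¹ * Real.exp (-E / R)) = 0 := by
  simp [Real.sqrt_eq_zero'.mpr hE]

/-- `ϑ¹_R` is measurable. -/
theorem k2r_ref_K1_measurable_th (R : ℝ) : Measurable (fun E => (Real.sqrt E * ((1 + E) ^ 4)⁻¹ * Real.exp (-E / R))) := by
  fun_prop

/-- The pointwise bound `ϑ¹_R(E) ≤ ½ (1+E)⁻³` for `E ≥ 0`, `R > 0`. -/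
theorem k2r_ref_K1_th_le {R E : ℝ} (hR : 0 < R) (hE : 0 ≤ E) :
    (Real.sqrt E * ((1 + E) ^ 4)⁻¹ * Real.exp (-E / R)) ≤ (1 / 2) * ((1 + E) ^ 3)⁻¹ := by
  have h1 : Real.exp (-E / R) ≤ 1 := Real.exp_le_one_iff.mpr (by
    rw [neg_div]; exact neg_nonpos.mpr (div_nonneg hE hR.le))
  have h2 := Literature.Barriers.AnomalousDissipation.Torus.sqrt_le_half_one_add hE
  have h3 : (0:ℝ) < 1 + E := by linarith
  calc Real.sqrt E * ((1 + E) ^ 4)⁻¹ * Real.exp (-E / R)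
      ≤ ((1 + E) / 2) * ((1 + E) ^ 4)⁻¹ * 1 := by gcongr
    _ = (1 / 2) * ((1 + E) ^ 3)⁻¹ := by field_simp

/-- `ϑ¹_R(E) ≤ √E (1+E)⁻⁴` (drop the exponential), for `E ≥ 0`, `R > 0`. -/
theorem k2r_ref_K1_th_le_sqrt {R E : ℝ} (hR : 0 < R) (hE : 0 ≤ E) :
    (Real.sqrt E * ((1 + E) ^ 4)⁻¹ * Real.exp (-E / R)) ≤ Real.sqrt E * ((1 + E) ^ 4)⁻¹ := by
  have h1 : Real.exp (-E / R) ≤ 1 := Real.exp_le_one_iff.mpr (by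
    rw [neg_div]; exact neg_nonpos.mpr (div_nonneg hE hR.le))
  have h0 : 0 ≤ Real.sqrt E * ((1 + E) ^ 4)⁻¹ := by positivity
  calc Real.sqrt E * ((1 + E) ^ 4)⁻¹ * Real.exp (-E / R)
      ≤ Real.sqrt E * ((1 + E) ^ 4)⁻¹ * 1 := by gcongr
    _ = _ := mul_one _

/-- **Tail below a primitive.** If `0 ≤ f ≤ -g` on `(a, ∞)` where `g = G'` on `[a, ∞)` and
`G → 0` at `+∞`, then `f` is integrable on `(a, ∞)` and `∫_{(a,∞)} f ≤ G(a)`. -/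
theorem k2r_ref_K1_tail_le {f G g : ℝ → ℝ} {a : ℝ} (hG : ∀ x ∈ Ici a, HasDerivAt G (g x) x)
    (hlim : Tendsto G atTop (𝓝 0)) (hfm : AEStronglyMeasurable f (volume.restrict (Ioi a)))
    (hf0 : ∀ x ∈ Ioi a, 0 ≤ f x) (hfg : ∀ x ∈ Ioi a, f x ≤ -g x) :
    IntegrableOn f (Ioi a) ∧ ∫ x in Ioi a, f x ≤ G a := by
  have hg0 : ∀ x ∈ Ioi a, g x ≤ 0 := fun x hx => by linarith [hf0 x hx, hfg x hx]
  have hgi : IntegrableOn g (Ioi a) := integrableOn_Ioi_deriv_of_nonpos' hG hg0 hlim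
  have hgv : ∫ x in Ioi a, g x = 0 - G a := integral_Ioi_of_hasDerivAt_of_nonpos' hG hg0 hlim
  have hfi : IntegrableOn f (Ioi a) := by
    refine Integrable.mono' hgi.neg hfm ?_
    refine ae_restrict_of_forall_mem measurableSet_Ioi fun x hx => ?_
    rw [Real.norm_eq_abs, abs_of_nonneg (hf0 x hx)]
    exact hfg x hx
  refine ⟨hfi, ?_⟩
  calc ∫ x in Ioi a, f x ≤ ∫ x in Ioi a, -g x :=
        setIntegral_mono_on hfi hgi.neg measurableSet_Ioi hfg
    _ = G a := by rw [integral_neg, hgv]; ring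

/-- `ϑ¹_R` is integrable on `(a, ∞)` for `a ≥ 0`, with `Θ̄¹_R(a) ≤ ¼ (1+a)⁻²`. -/
theorem k2r_ref_K1_th_tail {R a : ℝ} (hR : 0 < R) (ha : 0 ≤ a) :
    IntegrableOn (fun E => (Real.sqrt E * ((1 + E) ^ 4)⁻¹ * Real.exp (-E / R))) (Ioi a) ∧ (∫ y in Set.Ioi a, Real.sqrt y * ((1 + y) ^ 4)⁻¹ * Real.exp (-y / R)) ≤ (1 / 4) * ((1 + a) ^ 2)⁻¹ := by
  have key := k2r_ref_K1_tail_le (f := fun E => (Real.sqrt E * ((1 + E) ^ 4)⁻¹ * Real.exp (-E / R))) (G := fun x => (1 / 4) * ((1 + x) ^ 2)⁻¹)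
    (g := fun x => -((1 / 2) * ((1 + x) ^ 3)⁻¹)) (a := a) ?_ ?_
    (k2r_ref_K1_measurable_th R).aestronglyMeasurable (fun x _ => k2r_ref_K1_th_nonneg R x) ?_
  · exact key
  · intro x hx
    have hx1 : (1 + x) ≠ 0 := by have : a ≤ x := hx; exact ne_of_gt (by linarith)
    refine (((((hasDerivAt_id' x).const_add 1).fun_pow 2).fun_inv (pow_ne_zero 2 hx1)).const_mul
      (1 / 4 : ℝ)).congr_deriv ?_
    field_simp
    ring
  · have h1 : Tendsto (fun x : ℝ => (1 + x) ^ 2) atTop atTop := by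
      have : Tendsto (fun x : ℝ => 1 + x) atTop atTop := tendsto_atTop_add_const_left _ 1 tendsto_id
      exact (tendsto_pow_atTop two_ne_zero).comp this
    simpa using (tendsto_inv_atTop_zero.comp h1).const_mul (1 / 4 : ℝ)
  · intro x hx
    have hx0 : 0 ≤ x := ha.trans (le_of_lt hx)
    simpa using k2r_ref_K1_th_le hR hx0

/-- `ϑ¹_R` is integrable on `ℝ` (it vanishes on `(-∞, 0]`). -/
theorem k2r_ref_K1_integrable_th {R : ℝ} (hR : 0 < R) : Integrable (fun E => (Real.sqrt E * ((1 + E) ^ 4)⁻¹ * Real.exp (-E / R))) := by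
  rw [← integrableOn_univ, ← Iic_union_Ioi (a := (0:ℝ)), integrableOn_union]
  refine ⟨?_, (k2r_ref_K1_th_tail hR le_rfl).1⟩
  exact integrableOn_zero.congr_fun (fun x hx => (k2r_ref_K1_th_of_nonpos R (show x ≤ 0 from hx)).symm)
    measurableSet_Iic

/-- `Θ̄¹_R ≥ 0`. -/
theorem k2r_ref_K1_Tb_nonneg (R x : ℝ) : 0 ≤ (∫ y in Set.Ioi x, Real.sqrt y * ((1 + y) ^ 4)⁻¹ * Real.exp (-y / R)) :=
  setIntegral_nonneg measurableSet_Ioi fun E _ => k2r_ref_K1_th_nonneg R E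

/-- `Θ̄¹_R` is non-increasing. -/
theorem k2r_ref_K1_Tb_antitone {R : ℝ} (hR : 0 < R) : Antitone (fun x => (∫ y in Set.Ioi x, Real.sqrt y * ((1 + y) ^ 4)⁻¹ * Real.exp (-y / R))) := by
  intro x y hxy
  exact setIntegral_mono_set (k2r_ref_K1_integrable_th hR).integrableOn
    (ae_of_all _ fun E => k2r_ref_K1_th_nonneg R E) (Ioi_subset_Ioi hxy).eventuallyLE

/-- `Θ̄¹_R` is measurable. -/
theorem k2r_ref_K1_measurable_Tb {R : ℝ} (hR : 0 < R) : Measurable (fun x => (∫ y in Set.Ioi x, Real.sqrt y * ((1 + y) ^ 4)⁻¹ * Real.exp (-y / R))) :=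
  (k2r_ref_K1_Tb_antitone hR).measurable

/-- `Θ̄¹_R(x) ≤ ¼ (1+x)⁻²` for `x ≥ 0`; in particular `Θ̄¹_R ≤ ¼` there. -/
theorem k2r_ref_K1_Tb_le {R x : ℝ} (hR : 0 < R) (hx : 0 ≤ x) :
    (∫ y in Set.Ioi x, Real.sqrt y * ((1 + y) ^ 4)⁻¹ * Real.exp (-y / R)) ≤ (1 / 4) * ((1 + x) ^ 2)⁻¹ := (k2r_ref_K1_th_tail hR hx).2

/-- `Θ̄¹_R(x) ≤ ¼` for `x ≥ 0`. -/
theorem k2r_ref_K1_Tb_le_quarter {R x : ℝ} (hR : 0 < R) (hx : 0 ≤ x) : (∫ y in Set.Ioi x, Real.sqrt y * ((1 + y) ^ 4)⁻¹ * Real.exp (-y / R)) ≤ 1 / 4 := by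
  refine (k2r_ref_K1_Tb_le hR hx).trans ?_
  have h1 : (1:ℝ) ≤ (1 + x) ^ 2 := by nlinarith
  have h2 : ((1 + x) ^ 2)⁻¹ ≤ 1 := inv_le_one_of_one_le₀ h1
  linarith

/-- Increment bound: for `0 ≤ a ≤ b`, `Θ̄¹_R(a) - Θ̄¹_R(b) ≤ (b - a) · ½(1+a)⁻³`. -/
theorem k2r_ref_K1_Tb_sub_le {R a b : ℝ} (hR : 0 < R) (ha : 0 ≤ a) (hab : a ≤ b) :
    (∫ y in Set.Ioi a, Real.sqrt y * ((1 + y) ^ 4)⁻¹ * Real.exp (-y / R)) - (∫ y in Set.Ioi b, Real.sqrt y * ((1 + y) ^ 4)⁻¹ * Real.exp (-y / R)) ≤ (b - a) * ((1 / 2) * ((1 + a) ^ 3)⁻¹) := by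
  have hint := k2r_ref_K1_integrable_th hR
  have hsplit : (∫ y in Set.Ioi a, Real.sqrt y * ((1 + y) ^ 4)⁻¹ * Real.exp (-y / R)) = (∫ E in Ioc a b, (Real.sqrt E * ((1 + E) ^ 4)⁻¹ * Real.exp (-E / R))) + (∫ y in Set.Ioi b, Real.sqrt y * ((1 + y) ^ 4)⁻¹ * Real.exp (-y / R)) := by
    rw [← Ioc_union_Ioi_eq_Ioi hab, setIntegral_union Ioc_disjoint_Ioi_same measurableSet_Ioi
      hint.integrableOn hint.integrableOn]
  have hle : ∫ E in Ioc a b, (Real.sqrt E * ((1 + E) ^ 4)⁻¹ * Real.exp (-E / R)) ≤ ∫ E in Ioc a b, (1 / 2) * ((1 + a) ^ 3)⁻¹ := by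
    refine setIntegral_mono_on hint.integrableOn (by exact integrableOn_const (by simp)) measurableSet_Ioc ?_
    intro E hE
    have hE0 : 0 ≤ E := ha.trans hE.1.le
    refine (k2r_ref_K1_th_le hR hE0).trans ?_
    have h3 : (0:ℝ) < (1 + a) ^ 3 := by positivity
    gcongr
    · linarith [hE.1]
  rw [setIntegral_const, Measure.real, Real.volume_Ioc, ENNReal.toReal_ofReal (by linarith)] at hle
  simp only [smul_eq_mul] at hle
  linarith

/-! ### Model integrals (dominating functions) -/

/-- `∫₀^∞ dE / (√E (1+E)) = π`, with integrability. -/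
theorem k2r_ref_K1_model_M2 :
    IntegrableOn (fun E : ℝ => (Real.sqrt E * (1 + E))⁻¹) (Ioi 0) ∧
    ∫ E in Ioi (0:ℝ), (Real.sqrt E * (1 + E))⁻¹ = π := by
  have hderiv : ∀ E ∈ Ioi (0:ℝ), HasDerivAt (fun y => 2 * Real.arctan (Real.sqrt y))
      ((Real.sqrt E * (1 + E))⁻¹) E := by
    intro E hE
    have hE' : (0:ℝ) < E := hE
    have h1 := ((Real.hasDerivAt_arctan (Real.sqrt E)).comp E (Real.hasDerivAt_sqrt hE'.ne')).const_mul 2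
    refine h1.congr_deriv ?_
    have hsx : Real.sqrt E ≠ 0 := (Real.sqrt_pos.mpr hE').ne'
    rw [Real.sq_sqrt hE'.le]
    field_simp
  have hcont : ContinuousWithinAt (fun y => 2 * Real.arctan (Real.sqrt y)) (Ici 0) 0 :=
    (continuous_const.mul (Real.continuous_arctan.comp Real.continuous_sqrt)).continuousWithinAt
  have hpos : ∀ E ∈ Ioi (0:ℝ), 0 ≤ (Real.sqrt E * (1 + E))⁻¹ := by
    intro E hE; have : (0:ℝ) < E := hE; positivity
  have hlim : Tendsto (fun y => 2 * Real.arctan (Real.sqrt y)) atTop (𝓝 (2 * (π / 2))) :=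
    ((Real.tendsto_arctan_atTop.mono_right nhdsWithin_le_nhds).comp Real.tendsto_sqrt_atTop).const_mul 2
  refine ⟨integrableOn_Ioi_deriv_of_nonneg hcont hderiv hpos hlim, ?_⟩
  rw [integral_Ioi_of_hasDerivAt_of_nonneg hcont hderiv hpos hlim]
  simp; ring

/-- `∫₀^∞ R⁻¹ e^{-E/R} dE = 1` for `R > 0`, with integrability. -/
theorem k2r_ref_K1_model_exp {R : ℝ} (hR : 0 < R) :
    IntegrableOn (fun E : ℝ => R⁻¹ * Real.exp (-E / R)) (Ioi 0) ∧
    ∫ E in Ioi (0:ℝ), R⁻¹ * Real.exp (-E / R) = 1 := by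
  have hderiv : ∀ E ∈ Ioi (0:ℝ), HasDerivAt (fun y => -Real.exp (-y / R)) (R⁻¹ * Real.exp (-E / R)) E := by
    intro E _
    have h1 : HasDerivAt (fun y : ℝ => -y / R) (-1 / R) E := by
      simpa using ((hasDerivAt_id' E).neg).div_const R
    refine h1.exp.neg.congr_deriv ?_
    field_simp
  have hcont : ContinuousWithinAt (fun y => -Real.exp (-y / R)) (Ici 0) 0 := by
    apply Continuous.continuousWithinAt; fun_prop
  have hpos : ∀ E ∈ Ioi (0:ℝ), 0 ≤ R⁻¹ * Real.exp (-E / R) := fun E _ => by positivity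
  have hlim : Tendsto (fun y => -Real.exp (-y / R)) atTop (𝓝 (-0)) := by
    have h1 : Tendsto (fun y : ℝ => y / R) atTop atTop := tendsto_id.atTop_div_const hR
    have h2 := Real.tendsto_exp_neg_atTop_nhds_zero.comp h1
    have h3 : (fun y => Real.exp (-y / R)) = (fun x => Real.exp (-x)) ∘ fun y => y / R := by
      ext y; simp [neg_div]
    rw [← h3] at h2
    exact h2.neg
  refine ⟨integrableOn_Ioi_deriv_of_nonneg hcont hderiv hpos hlim, ?_⟩
  rw [integral_Ioi_of_hasDerivAt_of_nonneg hcont hderiv hpos hlim]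
  simp

/-! ### The exact tail identity and the bounds on its remainder terms -/

/-- **Exact identity for the dipole tail.** For `E > 0`:
`2 Θ̄¹_R(E) = (4/5) E ϑ¹_R(E) + (16/5) T - (4/(5R)) S` with `0 ≤ T ≤ ⅓(1+E)⁻³` and
`0 ≤ S ≤ e^{-E/R} / (√E (1+E))` (here `T = ∫_E^∞ √x (1+x)⁻⁵ e^{-x/R}`, `S = ∫_E^∞ x ϑ¹_R(x)`; obtained by
integrating `d/dx [x ϑ¹_R(x)] = ϑ¹_R(x) (3/2 - 4x/(1+x) - x/R)` over `(E, ∞)`). -/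
theorem k2r_ref_K1_Tb_identity {R E : ℝ} (hR : 0 < R) (hE : 0 < E) :
    ∃ T S : ℝ, 0 ≤ T ∧ T ≤ (1 / 3) * ((1 + E) ^ 3)⁻¹ ∧ 0 ≤ S ∧
      S ≤ Real.exp (-E / R) * (Real.sqrt E * (1 + E))⁻¹ ∧
      2 * (∫ y in Set.Ioi E, Real.sqrt y * ((1 + y) ^ 4)⁻¹ * Real.exp (-y / R)) = (4 / 5) * (E * (Real.sqrt E * ((1 + E) ^ 4)⁻¹ * Real.exp (-E / R))) + (16 / 5) * T - (4 / 5) * R⁻¹ * S := by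
  -- the three integrands
  set th := (fun y : ℝ => (Real.sqrt y * ((1 + y) ^ 4)⁻¹ * Real.exp (-y / R))) with hth
  let τ : ℝ → ℝ := fun x => Real.sqrt x * ((1 + x) ^ 5)⁻¹ * Real.exp (-x / R)
  let σ : ℝ → ℝ := fun x => x * th x
  have hexp1 : ∀ x, 0 ≤ x → Real.exp (-x / R) ≤ 1 := fun x hx =>
    Real.exp_le_one_iff.mpr (by rw [neg_div]; exact neg_nonpos.mpr (div_nonneg hx hR.le))
  -- T: integrable with bound
  have hT := k2r_ref_K1_tail_le (f := τ) (G := fun x => (1 / 3) * ((1 + x) ^ 3)⁻¹)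
    (g := fun x => -((1 + x) ^ 4)⁻¹) (a := E) ?_ ?_ ?_ ?_ ?_
  rotate_left
  · intro x hx
    have hx1 : (1 + x) ≠ 0 := by have : E ≤ x := hx; exact ne_of_gt (by linarith)
    refine (((((hasDerivAt_id' x).const_add 1).fun_pow 3).fun_inv (pow_ne_zero 3 hx1)).const_mul
      (1 / 3 : ℝ)).congr_deriv ?_
    field_simp; ring
  · have h1 : Tendsto (fun x : ℝ => (1 + x) ^ 3) atTop atTop :=
      (tendsto_pow_atTop three_ne_zero).comp (tendsto_atTop_add_const_left _ 1 tendsto_id)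
    simpa using (tendsto_inv_atTop_zero.comp h1).const_mul (1 / 3 : ℝ)
  · exact (by fun_prop : Measurable τ).aestronglyMeasurable
  · intro x hx; have : 0 < x := hE.trans hx; positivity
  · intro x hx
    have hx0 : 0 ≤ x := hE.le.trans (le_of_lt hx)
    have hx1 : 0 < 1 + x := by linarith
    have hs : Real.sqrt x ≤ 1 + x := (Literature.Barriers.AnomalousDissipation.Torus.sqrt_le_half_one_add hx0).trans (by linarith)
    show Real.sqrt x * ((1 + x) ^ 5)⁻¹ * Real.exp (-x / R) ≤ -(-((1 + x) ^ 4)⁻¹)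
    rw [neg_neg]
    calc Real.sqrt x * ((1 + x) ^ 5)⁻¹ * Real.exp (-x / R) ≤ (1 + x) * ((1 + x) ^ 5)⁻¹ * 1 := by
          gcongr; exact hexp1 x hx0
      _ = ((1 + x) ^ 4)⁻¹ := by field_simp
  -- S: integrable with bound (keep both decays)
  have hS := k2r_ref_K1_tail_le (f := fun x => x * Real.sqrt x * ((1 + x) ^ 4)⁻¹)
    (G := fun x => (Real.sqrt x * (1 + x))⁻¹)
    (g := fun x => -((1 + 3 * x) / (2 * Real.sqrt x * (Real.sqrt x * (1 + x)) ^ 2))) (a := E) ?_ ?_ ?_ ?_ ?_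
  rotate_left
  · intro x hx
    have hx0 : 0 < x := hE.trans_le hx
    have hsx : Real.sqrt x ≠ 0 := (Real.sqrt_pos.mpr hx0).ne'
    have hne : Real.sqrt x * (1 + x) ≠ 0 := mul_ne_zero hsx (by positivity)
    refine (((Real.hasDerivAt_sqrt hx0.ne').fun_mul ((hasDerivAt_id' x).const_add 1)).fun_inv
      hne).congr_deriv ?_
    have hsq : Real.sqrt x ^ 2 = x := Real.sq_sqrt hx0.le
    field_simp
    rw [hsq]; ring
  · have h1 : Tendsto (fun x : ℝ => Real.sqrt x * (1 + x)) atTop atTop :=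
      Real.tendsto_sqrt_atTop.atTop_mul_atTop₀ (tendsto_atTop_add_const_left _ 1 tendsto_id)
    exact tendsto_inv_atTop_zero.comp h1
  · exact (by fun_prop : Measurable fun x => x * Real.sqrt x * ((1 + x) ^ 4)⁻¹).aestronglyMeasurable
  · intro x hx; have : 0 < x := hE.trans hx; positivity
  · intro x hx
    have hx0 : 0 < x := hE.trans hx
    obtain ⟨s, hs, rfl⟩ : ∃ s, 0 < s ∧ x = s ^ 2 :=
      ⟨Real.sqrt x, Real.sqrt_pos.mpr hx0, (Real.sq_sqrt hx0.le).symm⟩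
    simp only [neg_neg, Real.sqrt_sq hs.le]
    rw [← one_div, mul_one_div, div_le_div_iff₀ (by positivity) (by positivity)]
    have h1 : (1 + 3 * s ^ 2) * (1 + s ^ 2) ^ 4 - s ^ 2 * s * (2 * s * (s * (1 + s ^ 2)) ^ 2)
        = (1 + s ^ 2) ^ 2 * (1 + 5 * s ^ 2 + 7 * s ^ 4 + s ^ 6) := by ring
    have h2 : 0 ≤ (1 + s ^ 2) ^ 2 * (1 + 5 * s ^ 2 + 7 * s ^ 4 + s ^ 6) := by positivity
    linarith
  -- σ = x ϑ(x): integrable on (E, ∞), with the two-decay bound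
  have hσm : AEStronglyMeasurable σ (volume.restrict (Ioi E)) := by
    have : Measurable σ := by
      show Measurable fun x => x * th x
      exact measurable_id.mul (hth ▸ k2r_ref_K1_measurable_th R)
    exact this.aestronglyMeasurable
  have hσle : ∀ x ∈ Ioi E, σ x ≤ Real.exp (-E / R) * (x * Real.sqrt x * ((1 + x) ^ 4)⁻¹) := by
    intro x hx
    have hx0 : 0 < x := hE.trans hx
    have hex : Real.exp (-x / R) ≤ Real.exp (-E / R) := by
      rw [Real.exp_le_exp, neg_div, neg_div, neg_le_neg_iff]
      exact div_le_div_of_nonneg_right (le_of_lt hx) hR.le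
    show x * (Real.sqrt x * ((1 + x) ^ 4)⁻¹ * Real.exp (-x / R)) ≤ _
    calc x * (Real.sqrt x * ((1 + x) ^ 4)⁻¹ * Real.exp (-x / R))
        = (x * Real.sqrt x * ((1 + x) ^ 4)⁻¹) * Real.exp (-x / R) := by ring
      _ ≤ (x * Real.sqrt x * ((1 + x) ^ 4)⁻¹) * Real.exp (-E / R) := by gcongr
      _ = _ := by ring
  have hσ0 : ∀ x, 0 ≤ σ x := fun x => by
    show 0 ≤ x * th x
    rcases le_or_gt x 0 with h | h
    · have h0 : th x = 0 := by rw [hth]; exact k2r_ref_K1_th_of_nonpos R h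
      rw [h0]; simp
    · exact mul_nonneg h.le (hth ▸ k2r_ref_K1_th_nonneg R x)
  have hσi : IntegrableOn σ (Ioi E) := by
    refine Integrable.mono' (hS.1.const_mul (Real.exp (-E / R))) hσm ?_
    refine ae_restrict_of_forall_mem measurableSet_Ioi fun x hx => ?_
    rw [Real.norm_eq_abs, abs_of_nonneg (hσ0 x)]
    exact hσle x hx
  have hSle : ∫ x in Ioi E, σ x ≤ Real.exp (-E / R) * (Real.sqrt E * (1 + E))⁻¹ := by
    calc ∫ x in Ioi E, σ x ≤ ∫ x in Ioi E, Real.exp (-E / R) * (x * Real.sqrt x * ((1 + x) ^ 4)⁻¹) :=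
          setIntegral_mono_on hσi (hS.1.const_mul _) measurableSet_Ioi hσle
      _ = Real.exp (-E / R) * ∫ x in Ioi E, x * Real.sqrt x * ((1 + x) ^ 4)⁻¹ := integral_const_mul _ _
      _ ≤ Real.exp (-E / R) * (Real.sqrt E * (1 + E))⁻¹ := by gcongr; exact hS.2
  -- the primitive P(x) = x ϑ(x) and its derivative ψ
  have hthi : IntegrableOn th (Ioi E) := (hth ▸ k2r_ref_K1_integrable_th hR).integrableOn
  let ψ : ℝ → ℝ := fun x => -(5 / 2) * th x + 4 * τ x - R⁻¹ * σ x
  have hderiv : ∀ x, 0 < x → HasDerivAt σ (ψ x) x := by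
    intro x hx
    have hx1 : (1 + x) ≠ 0 := by positivity
    have hs : HasDerivAt (fun y : ℝ => Real.sqrt y) (1 / (2 * Real.sqrt x)) x := Real.hasDerivAt_sqrt hx.ne'
    have hp : HasDerivAt (fun y : ℝ => ((1 + y) ^ 4)⁻¹) (-(4 * (1 + x) ^ 3) / ((1 + x) ^ 4) ^ 2) x := by
      simpa using (((hasDerivAt_id' x).const_add 1).fun_pow 4).fun_inv (pow_ne_zero 4 hx1)
    have he : HasDerivAt (fun y : ℝ => Real.exp (-y / R)) (Real.exp (-x / R) * (-1 / R)) x := by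
      have : HasDerivAt (fun y : ℝ => -y / R) (-1 / R) x := by
        simpa using ((hasDerivAt_id' x).neg).div_const R
      exact this.exp
    have hprod := ((hasDerivAt_id' x).fun_mul ((hs.fun_mul hp).fun_mul he))
    refine hprod.congr_deriv ?_
    have hsx : Real.sqrt x ≠ 0 := (Real.sqrt_pos.mpr hx).ne'
    have hsq : Real.sqrt x ^ 2 = x := Real.sq_sqrt hx.le
    simp only [ψ, σ, τ, hth]
    field_simp
    rw [hsq]; ring
  have hcont : ContinuousWithinAt σ (Ici E) E := (hderiv E hE).continuousAt.continuousWithinAt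
  have hψi : IntegrableOn ψ (Ioi E) :=
    ((hthi.const_mul _).add (hT.1.const_mul _)).sub (hσi.const_mul _)
  have hlim : Tendsto σ atTop (𝓝 0) := by
    have hup : Tendsto (fun x : ℝ => (1 + x)⁻¹) atTop (𝓝 0) :=
      tendsto_inv_atTop_zero.comp (tendsto_atTop_add_const_left _ 1 tendsto_id)
    refine tendsto_of_tendsto_of_tendsto_of_le_of_le' tendsto_const_nhds hup
      (Eventually.of_forall hσ0) ?_
    filter_upwards [eventually_ge_atTop 0] with x hx
    have hx1 : 0 < 1 + x := by linarith
    have hs : Real.sqrt x ≤ 1 + x := (Literature.Barriers.AnomalousDissipation.Torus.sqrt_le_half_one_add hx).trans (by linarith)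
    show x * th x ≤ _
    calc x * th x ≤ (1 + x) * ((1 / 2) * ((1 + x) ^ 3)⁻¹) :=
          mul_le_mul (by linarith) (hth ▸ k2r_ref_K1_th_le hR hx) (hth ▸ k2r_ref_K1_th_nonneg R x)
            (by linarith)
      _ ≤ (1 + x)⁻¹ := by
          rw [show (1 + x) * ((1 / 2) * ((1 + x) ^ 3)⁻¹) = (1 / 2) * ((1 + x) ^ 2)⁻¹ by field_simp]
          rw [show (1 + x)⁻¹ = (1 + x) * ((1 + x) ^ 2)⁻¹ by field_simp]
          gcongr
          linarith
  have hFTC := integral_Ioi_of_hasDerivAt_of_tendsto hcont (fun x hx => hderiv x (hE.trans hx)) hψi hlim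
  have hsplit : ∫ x in Ioi E, ψ x = -(5 / 2) * (∫ x in Ioi E, th x) + 4 * (∫ x in Ioi E, τ x)
      - R⁻¹ * ∫ x in Ioi E, σ x := by
    have i1 : Integrable (fun x => -(5 / 2) * th x) (volume.restrict (Ioi E)) := hthi.const_mul _
    have i2 : Integrable (fun x => 4 * τ x) (volume.restrict (Ioi E)) := hT.1.const_mul _
    have i3 : Integrable (fun x => R⁻¹ * σ x) (volume.restrict (Ioi E)) := hσi.const_mul _
    have i12 : Integrable (fun x => -(5 / 2) * th x + 4 * τ x) (volume.restrict (Ioi E)) := i1.add i2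
    show ∫ x in Ioi E, (-(5 / 2) * th x + 4 * τ x - R⁻¹ * σ x) = _
    rw [integral_sub i12 i3, integral_add i1 i2, integral_const_mul, integral_const_mul,
      integral_const_mul]
  refine ⟨∫ x in Ioi E, τ x, ∫ x in Ioi E, σ x,
    setIntegral_nonneg measurableSet_Ioi fun x hx => ?_, hT.2,
    setIntegral_nonneg measurableSet_Ioi fun x _ => hσ0 x, hSle, ?_⟩
  · have : 0 < x := hE.trans hx
    positivity
  · have hP : σ E = E * th E := rfl
    have hthE : th E = (Real.sqrt E * ((1 + E) ^ 4)⁻¹ * Real.exp (-E / R)) := by rw [hth]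
    rw [hsplit, hP, hthE] at hFTC
    linarith

/-- Keyed sub-goal of the stub `kernelDipole` (prep file): the tail bound `Θ̄¹_R(x) ≤ ¼(1+x)⁻²`. -/
theorem stub_kernelDipole_prep : ∀ R x : ℝ, 0 < R → 0 ≤ x → (∫ E in Set.Ioi x, Real.sqrt E * ((1 + E) ^ 4)⁻¹ * Real.exp (-E / R)) ≤ 1 / 4 * ((1 + x) ^ 2)⁻¹ :=
  fun _ _ hR hx => k2r_ref_K1_Tb_le hR hx

end Summit.AtomisticToContinuum.HydrodynamicLimit.Theorems.EnskogAdjointDuality
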